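import Summits.SmoothPoincare4.SmoothPoincare4.Theorems.SullivanDualWitnessChargeDefs
import Mathlib.Geometry.Manifold.ContMDiffMFDeriv
import Mathlib.Analysis.Normed.Operator.BoundedLinearMaps

/-!
# Sub-stub `substub_completePackaging` of the hard stub `stub_pencilOrRescale`, part 1: the
pulled-back structure `Ĵ = F^*J` and its continuity (crux `WitnessCharge`,
stmt-SmoothPoincare4-7824, route `SullivanDual`, line `Sketch`; card
`Cruxes/WitnessCharge/Lines/Sketch.md` (P6))

For a global diffeomorphism `F : ℂ × ℂ ≃ₘ Σ∖p` and an endomorphism field `J` of `T(Σ∖p)` we study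
the PULLED-BACK STRUCTURE `Ĵ_q = d(F⁻¹)_{F q} ∘ J_{F q} ∘ dF_q` on `ℂ × ℂ` (`pullbackJ`):

* `dF ∘ Ĵ = J ∘ dF` and `Ĵ² = -1` (chain rule for `F⁻¹ ∘ F = id`, `F ∘ F⁻¹ = id`);
* `Ĵ_q (0, ζ) = (0, i ζ)` when the slices `F(b, ·)` are pencil members (`IsPencilMember`, Defs
  file): they are `J`-holomorphic and `d(F(b, ·)) = dF ∘ inr`; hence the transverse part
  `P_q w = (Ĵ_q (w, 0)).1` satisfies `P_q² = -1`;
* **`Ĵ` is continuous** for `J` smooth in tangent coordinates (registered sub-goal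
  `substub_pullbackContinuous`): near `q₀`, in the chart at `F q₀`, `Ĵ` is the composite of the
  three coordinate expressions `inTangentCoordinates` of `d(F⁻¹)`, `J` and `dF`, each continuous at
  `q₀` (`ContMDiffAt.mfderiv_const` for `F`, `F⁻¹`; the smoothness hypothesis for `J`), the
  intermediate tangent coordinate changes cancelling (`VectorBundleCore.coordChange_comp`).

Part 2 (`SullivanDualWitnessChargeCompletePackaging.lean`) adds the far-parameter computation and the
orientation argument and proves `substub_completePackaging`.
-/

noncomputable section

-- the prescribed namespace `Summit.<P>.<Sub>.…` duplicates `SmoothPoincare4` (P = Sub)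
set_option linter.dupNamespace false

open scoped Manifold ContDiff Topology
open Set Filter Literature.Geometry.Symplectic Literature.Topology.FourManifolds

namespace Summit.SmoothPoincare4.SmoothPoincare4.Theorems.WitnessCharge.PencilIncompleteness

variable {S : HomotopySphere 4}

/-- Local notation for the model space `ℝ⁴`. -/
local notation "E4" => EuclideanSpace ℝ (Fin 4)

/-! ### Differentials of the diffeomorphism `F : ℂ × ℂ ≃ₘ Σ∖p` and of its inverse -/

section Pullback

variable {p : S.carrier} (J : ∀ x : punctured p, TangentSpace (𝓡 4) x →L[ℝ] TangentSpace (𝓡 4) x)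
  (F : (ℂ × ℂ) ≃ₘ⟮𝓘(ℝ, ℂ × ℂ), 𝓡 4⟯ (punctured p))

/-- `F` has derivative `dF_q` at `q`. -/
theorem hasMFDerivAt_diffeo (q : ℂ × ℂ) :
    HasMFDerivAt 𝓘(ℝ, ℂ × ℂ) (𝓡 4) F q (mfderiv 𝓘(ℝ, ℂ × ℂ) (𝓡 4) F q) :=
  (F.contMDiff.mdifferentiableAt (by simp)).hasMFDerivAt

/-- `d(F⁻¹)_{F q} ∘ dF_q = id` (chain rule for `F⁻¹ ∘ F = id` at `q`). -/
theorem mfderiv_symm_apply_mfderiv_self (q : ℂ × ℂ) (u : ℂ × ℂ) :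
    mfderiv (𝓡 4) 𝓘(ℝ, ℂ × ℂ) F.symm (F q) (mfderiv 𝓘(ℝ, ℂ × ℂ) (𝓡 4) F q u) = u := by
  have hF : MDifferentiableAt 𝓘(ℝ, ℂ × ℂ) (𝓡 4) F q := F.contMDiff.mdifferentiableAt (by simp)
  have hG : MDifferentiableAt (𝓡 4) 𝓘(ℝ, ℂ × ℂ) F.symm (F q) :=
    F.symm.contMDiff.mdifferentiableAt (by simp)
  have h := mfderiv_comp q hG hF
  have hid : ((F.symm : punctured p → ℂ × ℂ) ∘ (F : ℂ × ℂ → punctured p)) = id :=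
    funext F.symm_apply_apply
  rw [hid, mfderiv_id] at h
  exact (ContinuousLinearMap.ext_iff.1 h u).symm

/-- `d(F⁻¹)_x` is injective (it has the left inverse `dF_{F⁻¹ x}`: chain rule for `F ∘ F⁻¹ = id`). -/
theorem mfderiv_symm_injective (x : punctured p) :
    Function.Injective (mfderiv (𝓡 4) 𝓘(ℝ, ℂ × ℂ) F.symm x) := by
  have hF : MDifferentiableAt 𝓘(ℝ, ℂ × ℂ) (𝓡 4) F (F.symm x) :=
    F.contMDiff.mdifferentiableAt (by simp)
  have hG : MDifferentiableAt (𝓡 4) 𝓘(ℝ, ℂ × ℂ) F.symm x :=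
    F.symm.contMDiff.mdifferentiableAt (by simp)
  have h := mfderiv_comp x hF hG
  have hid : ((F : ℂ × ℂ → punctured p) ∘ (F.symm : punctured p → ℂ × ℂ)) = id :=
    funext F.apply_symm_apply
  rw [hid, mfderiv_id] at h
  intro v w hvw
  have h2 : (mfderiv 𝓘(ℝ, ℂ × ℂ) (𝓡 4) F (F.symm x)).comp (mfderiv (𝓡 4) 𝓘(ℝ, ℂ × ℂ) F.symm x) v =
      (mfderiv 𝓘(ℝ, ℂ × ℂ) (𝓡 4) F (F.symm x)).comp (mfderiv (𝓡 4) 𝓘(ℝ, ℂ × ℂ) F.symm x) w := by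
    simp only [ContinuousLinearMap.comp_apply, hvw]
  rw [← h] at h2
  exact h2

/-- `dF_q ∘ d(F⁻¹)_{F q} = id`. -/
theorem mfderiv_apply_mfderiv_symm_self (q : ℂ × ℂ) (v : TangentSpace (𝓡 4) (F q)) :
    mfderiv 𝓘(ℝ, ℂ × ℂ) (𝓡 4) F q (mfderiv (𝓡 4) 𝓘(ℝ, ℂ × ℂ) F.symm (F q) v) = v :=
  mfderiv_symm_injective F (F q) (by rw [mfderiv_symm_apply_mfderiv_self])

/-- The differential of the slice `ξ ↦ F (b, ξ)` is `dF_{(b, ξ)} ∘ inr`: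
`d(F(b, ·))(ξ) ζ = dF_{(b, ξ)} (0, ζ)`. -/
theorem mfderiv_slice_apply (b ξ ζ : ℂ) :
    mfderiv 𝓘(ℝ, ℂ) (𝓡 4) (fun ξ : ℂ => F (b, ξ)) ξ ζ =
      mfderiv 𝓘(ℝ, ℂ × ℂ) (𝓡 4) F (b, ξ) ((0 : ℂ), ζ) := by
  have hi : HasMFDerivAt 𝓘(ℝ, ℂ) 𝓘(ℝ, ℂ × ℂ) (fun ξ : ℂ => (b, ξ)) ξ
      (ContinuousLinearMap.inr ℝ ℂ ℂ) :=
    hasMFDerivAt_iff_hasFDerivAt.2 (hasFDerivAt_prodMk_right b ξ)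
  have h : HasMFDerivAt 𝓘(ℝ, ℂ) (𝓡 4) (fun ξ : ℂ => F (b, ξ)) ξ
      ((mfderiv 𝓘(ℝ, ℂ × ℂ) (𝓡 4) F (b, ξ)).comp (ContinuousLinearMap.inr ℝ ℂ ℂ)) :=
    (hasMFDerivAt_diffeo F (b, ξ)).comp ξ hi
  rw [h.mfderiv]
  rfl

/-! ### The pulled-back structure `Ĵ = F^* J` -/

/-- THE PULLED-BACK STRUCTURE `Ĵ_q = d(F⁻¹)_{F q} ∘ J_{F q} ∘ dF_q` on `ℂ × ℂ`. -/
def pullbackJ (q : ℂ × ℂ) : ℂ × ℂ →L[ℝ] ℂ × ℂ :=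
  (mfderiv (𝓡 4) 𝓘(ℝ, ℂ × ℂ) F.symm (F q)).comp
    ((J (F q)).comp (mfderiv 𝓘(ℝ, ℂ × ℂ) (𝓡 4) F q))

/-- Unfolding `pullbackJ`. -/
theorem pullbackJ_apply (q u : ℂ × ℂ) :
    pullbackJ J F q u = mfderiv (𝓡 4) 𝓘(ℝ, ℂ × ℂ) F.symm (F q)
      (J (F q) (mfderiv 𝓘(ℝ, ℂ × ℂ) (𝓡 4) F q u)) := rfl

/-- Conjugation: `dF ∘ Ĵ = J ∘ dF`. -/
theorem mfderiv_pullbackJ (q u : ℂ × ℂ) :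
    mfderiv 𝓘(ℝ, ℂ × ℂ) (𝓡 4) F q (pullbackJ J F q u) =
      J (F q) (mfderiv 𝓘(ℝ, ℂ × ℂ) (𝓡 4) F q u) := by
  rw [pullbackJ_apply, mfderiv_apply_mfderiv_symm_self]

/-- `Ĵ² = -1` (from `J² = -1`). -/
theorem pullbackJ_pullbackJ (hJ2 : ∀ (x : punctured p) (v : TangentSpace (𝓡 4) x), J x (J x v) = -v)
    (q u : ℂ × ℂ) : pullbackJ J F q (pullbackJ J F q u) = -u := by
  rw [pullbackJ_apply, mfderiv_pullbackJ, hJ2, map_neg, mfderiv_symm_apply_mfderiv_self]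
  rfl

/-- Holomorphic slices: `Ĵ_q (0, ζ) = (0, i ζ)` when every slice `F(b, ·)` is a pencil member. -/
theorem pullbackJ_slice (hmem : ∀ b : ℂ, IsPencilMember J (fun ξ => F (b, ξ)) b)
    (q : ℂ × ℂ) (ζ : ℂ) : pullbackJ J F q (0, ζ) = (0, Complex.I * ζ) := by
  obtain ⟨b, ξ⟩ := q
  have h := (hmem b).1.2.2 ξ ζ
  rw [mfderiv_slice_apply, mfderiv_slice_apply] at h
  rw [pullbackJ_apply, ← h, mfderiv_symm_apply_mfderiv_self]

/-- The TRANSVERSE PART `P_q w = (Ĵ_q (w, 0)).1` of the pulled-back structure. -/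
def transversePart (q : ℂ × ℂ) : ℂ →L[ℝ] ℂ :=
  (ContinuousLinearMap.fst ℝ ℂ ℂ).comp ((pullbackJ J F q).comp (ContinuousLinearMap.inl ℝ ℂ ℂ))

/-- Unfolding `transversePart`. -/
@[simp] theorem transversePart_apply (q : ℂ × ℂ) (w : ℂ) :
    transversePart J F q w = (pullbackJ J F q (w, 0)).1 := rfl

/-- The transverse part is a complex structure on the plane: `P_q (P_q w) = -w` (from `Ĵ² = -1`
and the invariance `Ĵ (0 × ℂ) ⊆ 0 × ℂ`). -/
theorem transversePart_transversePart
    (hJ2 : ∀ (x : punctured p) (v : TangentSpace (𝓡 4) x), J x (J x v) = -v)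
    (hmem : ∀ b : ℂ, IsPencilMember J (fun ξ => F (b, ξ)) b) (q : ℂ × ℂ) (w : ℂ) :
    transversePart J F q (transversePart J F q w) = -w := by
  have key : ∀ v : ℂ × ℂ, (pullbackJ J F q v).1 = (pullbackJ J F q (v.1, 0)).1 := by
    intro v
    conv_lhs => rw [show v = (v.1, 0) + (0, v.2) from by ext <;> simp]
    rw [map_add, pullbackJ_slice J F hmem]
    simp
  rw [transversePart_apply, transversePart_apply, ← key (pullbackJ J F q (w, 0)),
    pullbackJ_pullbackJ J F hJ2]
  simp

/-! ### Continuity of `Ĵ` -/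

/-- Cancellation of the tangent coordinate changes `x₀ → x → x₀` at `x`. -/
theorem coordChange_cancel {x₀ x : punctured p} (hx : x ∈ (chartAt E4 x₀).source) (v : E4) :
    (tangentBundleCore (𝓡 4) (punctured p)).coordChange (achart E4 x₀) (achart E4 x) x
      ((tangentBundleCore (𝓡 4) (punctured p)).coordChange (achart E4 x) (achart E4 x₀) x v) = v := by
  have h1 : x ∈ (tangentBundleCore (𝓡 4) (punctured p)).baseSet (achart E4 x) := by
    simpa only [tangentBundleCore_baseSet, coe_achart] using mem_chart_source E4 x
  have h0 : x ∈ (tangentBundleCore (𝓡 4) (punctured p)).baseSet (achart E4 x₀) := by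
    simpa only [tangentBundleCore_baseSet, coe_achart] using hx
  rw [(tangentBundleCore (𝓡 4) (punctured p)).coordChange_comp _ _ _ x ⟨⟨h1, h0⟩, h1⟩,
    (tangentBundleCore (𝓡 4) (punctured p)).coordChange_self _ x h1]

/-- **`Ĵ` is continuous** (for `J` smooth in tangent coordinates): near `q₀` it is the composite of
the coordinate expressions of `d(F⁻¹)`, `J` and `dF` in the chart at `F q₀`. -/
theorem continuous_pullbackJ
    (hJs : ∀ x₀ : punctured p, ContMDiffAt (𝓡 4) 𝓘(ℝ, EuclideanSpace ℝ (Fin 4) →L[ℝ]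
      EuclideanSpace ℝ (Fin 4)) ∞
      (inTangentCoordinates (𝓡 4) (𝓡 4) (id : punctured p → punctured p) id (fun x => J x) x₀) x₀) :
    Continuous (pullbackJ J F) := by
  refine continuous_iff_continuousAt.2 fun q₀ => ?_
  have hFc : Continuous (F : ℂ × ℂ → punctured p) := F.continuous
  have hA : ContinuousAt (inTangentCoordinates 𝓘(ℝ, ℂ × ℂ) (𝓡 4) id F
      (mfderiv 𝓘(ℝ, ℂ × ℂ) (𝓡 4) F) q₀) q₀ :=
    ((F.contMDiff.contMDiffAt (x := q₀)).mfderiv_const (m := 0) (by simp)).continuousAt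
  have hB : ContinuousAt (fun q => inTangentCoordinates (𝓡 4) (𝓡 4)
      (id : punctured p → punctured p) id (fun x => J x) (F q₀) (F q)) q₀ :=
    (hJs (F q₀)).continuousAt.comp hFc.continuousAt
  have hC : ContinuousAt (fun q => inTangentCoordinates (𝓡 4) 𝓘(ℝ, ℂ × ℂ) id F.symm
      (mfderiv (𝓡 4) 𝓘(ℝ, ℂ × ℂ) F.symm) (F q₀) (F q)) q₀ :=
    ((F.symm.contMDiff.contMDiffAt (x := F q₀)).mfderiv_const (m := 0)
      (by simp)).continuousAt.comp hFc.continuousAt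
  have hABC := hC.clm_comp (hB.clm_comp hA)
  refine (continuousAt_congr ?_).2 hABC
  have hsrc : ∀ᶠ q in 𝓝 q₀, F q ∈ (chartAt E4 (F q₀)).source :=
    hFc.continuousAt.preimage_mem_nhds
      ((chartAt E4 (F q₀)).open_source.mem_nhds (mem_chart_source E4 (F q₀)))
  filter_upwards [hsrc] with q hq
  rw [inTangentCoordinates_eq (x₀ := q₀) (x := q) id F _ (by simp) hq,
    inTangentCoordinates_eq (x₀ := F q₀) (x := F q) id id _ hq hq,
    inTangentCoordinates_eq (x₀ := F q₀) (x := F q) id F.symm _ hq (by simp)]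
  refine ContinuousLinearMap.ext fun u => ?_
  simp only [ContinuousLinearMap.comp_apply, tangentBundleCore_coordChange_model_space,
    ContinuousLinearMap.id_apply, id_eq, coordChange_cancel hq, pullbackJ_apply]
  rfl

/-- The transverse part is continuous. -/
theorem continuous_transversePart
    (hJs : ∀ x₀ : punctured p, ContMDiffAt (𝓡 4) 𝓘(ℝ, EuclideanSpace ℝ (Fin 4) →L[ℝ]
      EuclideanSpace ℝ (Fin 4)) ∞
      (inTangentCoordinates (𝓡 4) (𝓡 4) (id : punctured p → punctured p) id (fun x => J x) x₀) x₀) :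
    Continuous (transversePart J F) :=
  continuous_const.clm_comp ((continuous_pullbackJ J F hJs).clm_comp continuous_const)

end Pullback

/-! ### The registered sub-goal: continuity of the pulled-back structure -/

/-- **Registered sub-goal `substub_pullbackContinuous`** (part 1 of `substub_completePackaging`):
for `J` smooth in tangent coordinates and a diffeomorphism `F : ℂ × ℂ ≃ₘ Σ∖p`, the pulled-back
structure `Ĵ_q = d(F⁻¹)_{F q} ∘ J_{F q} ∘ dF_q` is a CONTINUOUS family of endomorphisms of `ℂ × ℂ`. -/
theorem substub_pullbackContinuous :
    ∀ (S : HomotopySphere 4) (p : S.carrier)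
      (J : ∀ x : punctured p, TangentSpace (𝓡 4) x →L[ℝ] TangentSpace (𝓡 4) x),
      (∀ x₀ : punctured p, ContMDiffAt (𝓡 4) 𝓘(ℝ, EuclideanSpace ℝ (Fin 4) →L[ℝ] EuclideanSpace ℝ (Fin 4)) ∞
        (inTangentCoordinates (𝓡 4) (𝓡 4) (id : punctured p → punctured p) id (fun x => J x) x₀) x₀) →
      ∀ (F : (ℂ × ℂ) ≃ₘ⟮𝓘(ℝ, ℂ × ℂ), 𝓡 4⟯ (punctured p)),
        ∃ Jhat : ℂ × ℂ → (ℂ × ℂ →L[ℝ] ℂ × ℂ), Continuous Jhat ∧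
          ∀ q u : ℂ × ℂ, Jhat q u = mfderiv (𝓡 4) 𝓘(ℝ, ℂ × ℂ) F.symm (F q)
            (J (F q) (mfderiv 𝓘(ℝ, ℂ × ℂ) (𝓡 4) F q u)) := by
  intro S p J hJs F
  exact ⟨pullbackJ J F, continuous_pullbackJ J F hJs, fun q u => rfl⟩

end Summit.SmoothPoincare4.SmoothPoincare4.Theorems.WitnessCharge.PencilIncompleteness
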